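import Mathlib
import Summits.Ventures.PercRepro2.LeafRowPendantRootMirrorB
import Summits.Ventures.PercRepro2.HCovCubic
import Summits.Ventures.PercRepro2.TriDisagreementPinned

/-!
# The open sign `crossA′so` as a three-copy cubic form, and its weight-free typed bases
(blind cell PercRepro2, p5 g32; `proofs/P5-OEDGE.md` §42, S4 §2.4 (s) addendum 18)

The second-order mirror (A)-term of the pendant root,
`crossA′so = 2Z·P(Q,vL,oH,bH) − P(Q,bH)·P(Q,vL,oH) + π_v·P(Q,oH)·P(Q,bH) − P(Q,oH)·P(Q,vL,bH)`
(`LeafRowPendantRootSO.crossA'so`), is a sum of four products of at most three probabilities, hence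
the cubic form `Σ_{x,y,z} P(x) P(y) P(z) K_{A′}(x, y, z)` of the four-term separable kernel

  `K_{A′} x y z = 2·1_Q(x)·1_{Q,vL,oH,bH}(y) + 1_{Q,oH}(x)·1_{Q,bH}(y)·1_{vL}(z)
                 − 1_{Q,bH}(x)·1_{Q,vL,oH}(y) − 1_{Q,oH}(x)·1_{Q,vL,bH}(y)`

(`KAprime`, a `CovForm.sepKernel`; **`crossA'so_cubic`**, the analogue of `hcov_cubic`).  Through
p1's three-copy reduction (`triSum_nonneg_of_typedCount`, `TriDisagreementPinned.lean`) the sign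
`0 ≤ crossA′so` for EVERY admissible weight vector follows from the WEIGHT-FREE statement that every
typed 3-colouring count `typedCount F z τ K_{A′}` with types in `{1, 2}` on the free edges `F` is
nonnegative — the multivariate Bernstein coefficients of `crossA′so` (**`CrossAPrimeTypedBases`**,
the cell's combinatorial conjecture of record for the open sign: census 0 negative / ≈ 6.2 M
coefficient classes on 57 instances n ≤ 7, m ≤ 11 at the time of writing; kit j330315 / j330317),
**`crossA'so_nonneg_of_typedBases`**.  With `LeafRow_pendant_root_of_crossA'so` this closes the
pendant-root case of row (LEAF-½) modulo the typed bases (**`LeafRow_pendant_root_of_typedBases`**).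
Nothing here claims the typed bases.  Own work; standard axioms.
-/

namespace Summit.Ventures.PercRepro2

open CovForm LeafStep LeafRowPendantRootSO LeafRowPendantRootMirrorB

namespace CrossAPrimeCubic

section Kernel

variable {V : Type*} {E : Type*} [Fintype E] [DecidableEq E] {R : Type*} [Field R]

/-- `1_{Q ∩ oH}` with `Q = {a₂ ↮ a₁}`, `oH = {a₂ ↔ o}`. -/
noncomputable def iQH (ends : E → Sym2 V) (a₁ a₂ o : V) : Config E → R :=
  (avoidAll ends a₂ {a₁} ∩ connEvent ends a₂ o).indicator 1

/-- `1_{Q ∩ vL ∩ oH}` with `vL = {a₁ ↔ v}`. -/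
noncomputable def iQLH (ends : E → Sym2 V) (a₁ a₂ v o : V) : Config E → R :=
  (avoidAll ends a₂ {a₁} ∩ (connEvent ends a₁ v ∩ connEvent ends a₂ o)).indicator 1

/-- `1_{Q ∩ vL ∩ oH ∩ bH}`. -/
noncomputable def iQLHH (ends : E → Sym2 V) (a₁ a₂ v o b : V) : Config E → R :=
  (avoidAll ends a₂ {a₁} ∩ (connEvent ends a₁ v ∩ (connEvent ends a₂ o ∩ connEvent ends a₂ b))).indicator 1

/-- **The four-term kernel of `crossA′so`**:
`K_{A′} x y z = 2·1_Q(x)·1_{Q,vL,oH,bH}(y) + 1_{Q,oH}(x)·1_{Q,bH}(y)·1_{vL}(z) − 1_{Q,bH}(x)·1_{Q,vL,oH}(y)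
− 1_{Q,oH}(x)·1_{Q,vL,bH}(y)`. -/
noncomputable def KAprime (ends : E → Sym2 V) (o a₁ a₂ v b : V) :
    Config E → Config E → Config E → R :=
  sepKernel ![2, 1, -1, -1]
    ![iQ ends a₁ a₂, iQH ends a₁ a₂ o, iQH ends a₁ a₂ b, iQH ends a₁ a₂ o]
    ![iQLHH ends a₁ a₂ v o b, iQH ends a₁ a₂ b, iQLH ends a₁ a₂ v o, iQLH ends a₁ a₂ v b]
    ![fun _ => 1, iL ends a₁ v, fun _ => 1, fun _ => 1]

/-- `E[1] = 1`. -/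
lemma expect_one (p : E → R) : expect p (fun _ : Config E => (1 : R)) = 1 := by
  unfold expect
  simp [sum_weight]

/-- **`crossA′so` is the cubic form of `K_{A′}`**:
`crossA′so = Σ_{x,y,z} P(x) P(y) P(z) K_{A′}(x, y, z)` (`triSum p ∅ τ K_{A′}` for any `τ`). -/
theorem crossA'so_cubic (p : E → R) (ends : E → Sym2 V) (o a₁ a₂ v b : V) (τ : E → ℕ) :
    crossA'so p ends o a₁ a₂ v b = triSum p ∅ τ (KAprime ends o a₁ a₂ v b) := by
  unfold KAprime
  rw [triSum_empty_sepKernel]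
  simp only [Fin.sum_univ_succ, Fin.sum_univ_zero, Matrix.cons_val_zero, Matrix.cons_val_succ,
    add_zero]
  unfold iQ iQH iQLH iQLHH iL
  simp only [expect_one, expect_ind1]
  unfold crossA'so
  ring

end Kernel

section Bases

variable {V : Type*} {E : Type*} [Fintype E] [DecidableEq E] {R : Type*} [Field R]
  [LinearOrder R] [IsStrictOrderedRing R]

/-- **The typed bases of the open sign** (weight-free; the cell's combinatorial conjecture of record
for `crossA′so ≥ 0`, NOT a theorem): every typed three-copy count of `K_{A′}` with types in `{1, 2}`
on the free edges is nonnegative — equivalently, every multivariate Bernstein coefficient of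
`crossA′so` in the edge weights is nonnegative. -/
def CrossAPrimeTypedBases (ends : E → Sym2 V) (o a₁ a₂ v b : V) : Prop :=
  ∀ (F : Finset E) (z : Config E) (τ : E → ℕ), (∀ e ∈ F, τ e = 1 ∨ τ e = 2) →
    0 ≤ typedCount F z τ (KAprime ends o a₁ a₂ v b : Config E → Config E → Config E → R)

/-- **The open sign from its typed bases**, for every admissible weight vector. -/
theorem crossA'so_nonneg_of_typedBases {ends : E → Sym2 V} {o a₁ a₂ v b : V}
    (h : CrossAPrimeTypedBases (R := R) ends o a₁ a₂ v b) (p : E → R) (hp : IsProbVec p) :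
    0 ≤ crossA'so p ends o a₁ a₂ v b := by
  rw [crossA'so_cubic p ends o a₁ a₂ v b (fun _ => 0)]
  exact triSum_nonneg_of_typedCount (KAprime ends o a₁ a₂ v b) h p
    (fun e => ⟨hp.nonneg e, hp.le_one e⟩) ∅ (fun _ => 0)
    (fun e he => absurd he (Finset.notMem_empty e))

end Bases

section Assembly

variable {V : Type*} {E : Type*} [Fintype E] [DecidableEq E] [Fintype V] [DecidableEq V]
  {R : Type*} [Field R] [LinearOrder R] [IsStrictOrderedRing R]
variable {ends : E → Sym2 V} {p : E → R} {e : E} {a₂ z : V}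

/-- **Row (LEAF-½) at a pendant root modulo the typed bases of the open sign**: the row at the
contraction `a₂ := z` and the weight-free typed bases give the row at the pendant instance, for
every weight of the root edge. -/
theorem LeafRow_pendant_root_of_typedBases (hp : IsProbVec p) (hleaf : ∀ f, a₂ ∈ ends f → f = e)
    (hends : ends e = s(a₂, z)) {o a₁ v b : V} (ho : o ≠ a₂) (h1 : a₁ ≠ a₂) (hv : v ≠ a₂)
    (hb : b ≠ a₂) (hrow : LeafRow (Function.update p e 1) ends o a₁ a₂ v b)
    (hT : CrossAPrimeTypedBases (R := R) ends o a₁ a₂ v b) :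
    LeafRow p ends o a₁ a₂ v b :=
  LeafRow_pendant_root_of_crossA'so hp hleaf hends ho h1 hv hb hrow
    (crossA'so_nonneg_of_typedBases hT _ (hp.update e zero_le_one le_rfl))

end Assembly

end CrossAPrimeCubic

end Summit.Ventures.PercRepro2
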